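import Summits.SmoothPoincare4.SmoothPoincare4.Theses.EntropyRung
import Summits.SmoothPoincare4.SmoothPoincare4.Theorems.EntropyRungSubcylindricalExistenceRoundClauseEuclidean
import Summits.SmoothPoincare4.SmoothPoincare4.Theorems.EntropyRungSubcylindricalExistenceSphereSideClauseAux
import Mathlib.Analysis.Calculus.LineDeriv.IntegrationByParts
import Mathlib.Analysis.Calculus.Gradient.Basic
import Mathlib.Analysis.InnerProductSpace.Calculus
import Mathlib.Analysis.SpecialFunctions.Log.Basic
import HarnessLib

/-!
# Analytic helpers for stub `stub_capClauseEuclideanSchwarzschild` (E2, line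
# `green-blowup-conformal-entropy`, reshape R-c3, crux `EntropyRung.SubcylindricalExistence`,
# item stmt-SmoothPoincare4-10871)

Pure calculus on `ℝ⁴ = EuclideanSpace ℝ (Fin 4)` for the perturbative cap clause in the
Schwarzschild gauge (main file `…CapClauseEuclideanSchwarzschild.lean`):
* Euler's identity `∫ ⟨∇F, z⟩ = −4∫F` for `F ∈ C¹_c(ℝ⁴)` (coordinatewise integration by parts,
  `integral_mul_fderiv_eq_neg_fderiv_mul_of_integrable`) and the **Hardy identity** of the bubble
  `ψ₀ = C/(‖z‖²+E)`: `∫ C²(‖z‖²−4E)/(‖z‖²+E)⁴ w² ≤ ∫ ψ₀²‖∇w‖²` for `w ∈ C^∞_c` (registered helper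
  `helper_capClauseEuclideanSchwarzschild`);
* the RoundBound for the bubble `ψ₀` at every scale `τ` with curvature weight `48E/C²`
  (`roundClause_profile`: the landed S1 `stub_roundClauseEuclidean` at `l² = 4/E`, `σ = 4Eτ/C²`);
* gradients of `u = μ(1+β‖y‖²)` and of the substituted test function `w = u²v`.
References: Lee–Parker 1987, §3, §6; Cao–Hamilton–Ilmanen 2004, Thm 3.4. [folklore]
-/

noncomputable section

-- the registered namespace `Summit.SmoothPoincare4.SmoothPoincare4.Theorems` repeats a component
set_option linter.dupNamespace false

open scoped Manifold ContDiff Topology RealInnerProductSpace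
open Set Filter MeasureTheory

namespace Summit.SmoothPoincare4.SmoothPoincare4.Theorems

namespace CapClauseEuclideanSchwarzschildAux

open SphereSideClause

/-- Integration by parts against a coordinate: `∫ ⟪e, z⟫ ∂_e F = −‖e‖² ∫ F` for `F ∈ C¹_c(ℝ⁴)`
(`integral_mul_fderiv_eq_neg_fderiv_mul_of_integrable`). [folklore] -/
theorem integral_inner_mul_fderiv (F : EuclideanSpace ℝ (Fin 4) → ℝ) (hF : ContDiff ℝ 1 F)
    (hc : HasCompactSupport F) (e : EuclideanSpace ℝ (Fin 4)) :
    ∫ z, ⟪e, z⟫ * fderiv ℝ F z e = - (‖e‖ ^ 2 * ∫ z, F z) := by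
  have h1 : ∀ z : EuclideanSpace ℝ (Fin 4), fderiv ℝ (fun z => ⟪e, z⟫) z e = ‖e‖ ^ 2 := by
    intro z
    rw [show (fun z : EuclideanSpace ℝ (Fin 4) => ⟪e, z⟫) = innerSL ℝ e from rfl,
      ContinuousLinearMap.fderiv]
    simp
  have hFc : Continuous F := hF.continuous
  have hdFc : Continuous fun z ↦ fderiv ℝ F z e :=
    (hF.continuous_fderiv one_ne_zero).clm_apply continuous_const
  have hdFs : HasCompactSupport fun z ↦ fderiv ℝ F z e :=
    hc.fderiv_apply (𝕜 := ℝ) e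
  have key := integral_mul_fderiv_eq_neg_fderiv_mul_of_integrable (μ := volume)
    (f := fun z : EuclideanSpace ℝ (Fin 4) => ⟪e, z⟫) (g := F) (v := e) ?_ ?_ ?_ ?_ ?_
  · rw [key]
    simp only [h1]
    rw [integral_const_mul]
  · simp only [h1]
    exact (hFc.integrable_of_hasCompactSupport hc).const_mul _
  · exact (((innerSL ℝ e).continuous).mul hdFc).integrable_of_hasCompactSupport hdFs.mul_left
  · exact (((innerSL ℝ e).continuous).mul hFc).integrable_of_hasCompactSupport hc.mul_left
  · intro x _
    exact (innerSL ℝ e).differentiableAt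
  · intro x _
    exact hF.differentiable one_ne_zero x

/-- Euler's identity `∫ ⟨∇F(z), z⟩ dz = −4 ∫ F` for `F ∈ C¹_c(ℝ⁴)` (the divergence of `z ↦ F(z) z`
integrates to zero). [folklore] -/
theorem integral_fderiv_apply_self (F : EuclideanSpace ℝ (Fin 4) → ℝ) (hF : ContDiff ℝ 1 F)
    (hc : HasCompactSupport F) :
    ∫ z, fderiv ℝ F z z = -(4 * ∫ z, F z) := by
  set b := EuclideanSpace.basisFun (Fin 4) ℝ with hb
  have hexp : ∀ z : EuclideanSpace ℝ (Fin 4),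
      fderiv ℝ F z z = ∑ i, ⟪b i, z⟫ * fderiv ℝ F z (b i) := by
    intro z
    have h := congr_arg (fderiv ℝ F z) (b.sum_repr' z).symm
    rw [h, map_sum]
    simp only [map_smul, smul_eq_mul]
  simp_rw [hexp]
  rw [integral_finsetSum]
  · simp_rw [integral_inner_mul_fderiv F hF hc, b.orthonormal.1, one_pow, one_mul]
    simp only [Finset.sum_const, Finset.card_univ, Fintype.card_fin]
    ring
  · intro i _
    have hdFc : Continuous fun z ↦ fderiv ℝ F z (b i) :=
      (hF.continuous_fderiv one_ne_zero).clm_apply continuous_const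
    exact (((innerSL ℝ (b i)).continuous).mul hdFc).integrable_of_hasCompactSupport
      (hc.fderiv_apply (𝕜 := ℝ) (b i)).mul_left

/-- The derivative of the Hardy potential `z ↦ w(z)² · (−2C²/(‖z‖²+E)³)`. [folklore] -/
theorem hasFDerivAt_hardyF {C E : ℝ} (hE : 0 < E) {w : EuclideanSpace ℝ (Fin 4) → ℝ}
    {w' : EuclideanSpace ℝ (Fin 4) →L[ℝ] ℝ} {z : EuclideanSpace ℝ (Fin 4)}
    (hw : HasFDerivAt w w' z) :
    HasFDerivAt (fun z ↦ w z ^ 2 * (-2 * C ^ 2 / (‖z‖ ^ 2 + E) ^ 3))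
      ((2 * w z * (-2 * C ^ 2 / (‖z‖ ^ 2 + E) ^ 3)) • w' +
        (w z ^ 2 * (6 * C ^ 2 / (‖z‖ ^ 2 + E) ^ 4)) • (2 • innerSL ℝ z)) z := by
  have hm : HasFDerivAt (fun z : EuclideanSpace ℝ (Fin 4) ↦ ‖z‖ ^ 2) (2 • innerSL ℝ z) z :=
    (hasStrictFDerivAt_norm_sq z).hasFDerivAt
  have hpos : (‖z‖ ^ 2 + E) ≠ 0 := by positivity
  have hφ : HasDerivAt (fun s : ℝ ↦ -2 * C ^ 2 / (s + E) ^ 3) (6 * C ^ 2 / (‖z‖ ^ 2 + E) ^ 4)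
      (‖z‖ ^ 2) := by
    have h1 : HasDerivAt (fun s : ℝ ↦ (s + E) ^ 3) (3 * (‖z‖ ^ 2 + E) ^ 2) (‖z‖ ^ 2) := by
      simpa using ((hasDerivAt_id (‖z‖ ^ 2)).add_const E).fun_pow 3
    refine ((hasDerivAt_const _ (-2 * C ^ 2)).div h1 (pow_ne_zero 3 hpos)).congr_deriv ?_
    field_simp
    ring
  have h2 := hφ.comp_hasFDerivAt z hm
  have h3 := (hw.pow 2).mul h2
  refine h3.congr_fderiv ?_
  ext y
  simp only [_root_.add_apply, FunLike.coe_smul, Pi.smul_apply, smul_eq_mul,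
    Function.comp_apply]
  ring

/-- The gradient of a `C¹` function is continuous. [folklore] -/
theorem continuous_gradient {w : EuclideanSpace ℝ (Fin 4) → ℝ} (hw : ContDiff ℝ 1 w) :
    Continuous (gradient w) :=
  (InnerProductSpace.toDual ℝ (EuclideanSpace ℝ (Fin 4))).symm.continuous.comp
    (hw.continuous_fderiv one_ne_zero)

/-- The gradient vanishes off the topological support. [folklore] -/
theorem gradient_eq_zero_of_notMem {w : EuclideanSpace ℝ (Fin 4) → ℝ} {z : EuclideanSpace ℝ (Fin 4)}
    (hz : z ∉ tsupport w) : gradient w z = 0 := by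
  rw [(notMem_tsupport_iff_eventuallyEq.1 hz).gradient_eq]
  exact gradient_fun_const z 0

/-- **Hardy identity for the bubble `ψ₀ = C/(‖z‖²+E)` on `ℝ⁴`.** For `w ∈ C^∞_c(ℝ⁴)`,
`∫ w² (¼‖∇ψ₀‖² + ½ ψ₀ Δψ₀) = ∫ C²(‖z‖² − 4E)/(‖z‖²+E)⁴ w² ≤ ∫ ψ₀² ‖∇w‖²`: pointwise
`ψ₀²‖∇w‖² − C²(m−4E)/(m+E)⁴ w² + ½ div(w² ψ₀∇ψ₀) = ‖ψ₀∇w + ½ w∇ψ₀‖² ≥ 0`, and the divergence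
`= ½(⟨∇F, z⟩ + 4F)`, `F = w² · (−2C²/(m+E)³)`, integrates to zero (`integral_fderiv_apply_self`).
[cite: LeeParker1987, §6] [folklore] -/
theorem hardy {C E : ℝ} (hE : 0 < E) {w : EuclideanSpace ℝ (Fin 4) → ℝ}
    (hw : ContDiff ℝ ∞ w) (hwc : HasCompactSupport w) :
    ∫ z, C ^ 2 * (‖z‖ ^ 2 - 4 * E) / (‖z‖ ^ 2 + E) ^ 4 * w z ^ 2 ≤
      ∫ z, (C / (‖z‖ ^ 2 + E)) ^ 2 * ‖gradient w z‖ ^ 2 := by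
  set F : EuclideanSpace ℝ (Fin 4) → ℝ := fun z ↦ w z ^ 2 * (-2 * C ^ 2 / (‖z‖ ^ 2 + E) ^ 3)
    with hF
  have hpos : ∀ z : EuclideanSpace ℝ (Fin 4), (‖z‖ ^ 2 + E) ≠ 0 := fun z ↦ by positivity
  have hw1 : ContDiff ℝ 1 w := hw.of_le (by exact_mod_cast le_top)
  have hFs : ContDiff ℝ 1 F := by
    refine (hw1.pow 2).mul (contDiff_const.div ?_ fun z ↦ pow_ne_zero 3 (hpos z))
    exact ((contDiff_norm_sq ℝ).add contDiff_const).pow 3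
  have hFc : HasCompactSupport F := hwc.mono fun z hz ↦ mt (fun h ↦ by simp [hF, h]) hz
  have hEuler := integral_fderiv_apply_self F hFs hFc
  have hdF : ∀ z, fderiv ℝ F z z = 2 * w z * (-2 * C ^ 2 / (‖z‖ ^ 2 + E) ^ 3) * ⟪gradient w z, z⟫
      + w z ^ 2 * (6 * C ^ 2 / (‖z‖ ^ 2 + E) ^ 4) * (2 * ‖z‖ ^ 2) := by
    intro z
    rw [(hasFDerivAt_hardyF (C := C) hE (hw1.differentiable one_ne_zero z).hasFDerivAt).fderiv]
    simp only [_root_.add_apply, FunLike.coe_smul, Pi.smul_apply,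
      smul_eq_mul, innerSL_apply_apply, real_inner_self_eq_norm_sq, inner_gradient_left]
    ring
  have hpt : ∀ z, (C / (‖z‖ ^ 2 + E)) ^ 2 * ‖gradient w z‖ ^ 2
      - C ^ 2 * (‖z‖ ^ 2 - 4 * E) / (‖z‖ ^ 2 + E) ^ 4 * w z ^ 2
      + (1 / 2) * (fderiv ℝ F z z + 4 * F z) =
      ‖(C / (‖z‖ ^ 2 + E)) • gradient w z - (C * w z / (‖z‖ ^ 2 + E) ^ 2) • z‖ ^ 2 := by
    intro z
    rw [hdF z, norm_sub_sq_real, norm_smul, norm_smul, real_inner_smul_left, real_inner_smul_right,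
      Real.norm_eq_abs, Real.norm_eq_abs, mul_pow, mul_pow, sq_abs, sq_abs]
    simp only [hF]
    field_simp
    ring
  have hgc : Continuous (gradient w) := continuous_gradient hw1
  have hψc : Continuous fun z : EuclideanSpace ℝ (Fin 4) ↦ C / (‖z‖ ^ 2 + E) :=
    continuous_const.div ((continuous_norm.pow 2).add continuous_const) hpos
  have hI2 : Integrable fun z ↦ (C / (‖z‖ ^ 2 + E)) ^ 2 * ‖gradient w z‖ ^ 2 := by
    refine ((hψc.pow 2).mul ((continuous_norm.comp hgc).pow 2)).integrable_of_hasCompactSupport ?_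
    refine HasCompactSupport.intro hwc fun z hz ↦ ?_
    simp [gradient_eq_zero_of_notMem hz]
  have hI3 : Integrable fun z ↦ C ^ 2 * (‖z‖ ^ 2 - 4 * E) / (‖z‖ ^ 2 + E) ^ 4 * w z ^ 2 := by
    refine Continuous.integrable_of_hasCompactSupport ?_ ?_
    · exact ((continuous_const.mul ((continuous_norm.pow 2).sub continuous_const)).div
        (((continuous_norm.pow 2).add continuous_const).pow 4) fun z ↦ pow_ne_zero 4 (hpos z)).mul
        (hw.continuous.pow 2)
    · exact hwc.mono fun z hz ↦ mt (fun h ↦ by simp [h]) hz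
  have hIF : Integrable F := hFs.continuous.integrable_of_hasCompactSupport hFc
  have hIdF : Integrable fun z ↦ fderiv ℝ F z z := by
    refine ((hFs.continuous_fderiv one_ne_zero).clm_apply
      continuous_id).integrable_of_hasCompactSupport ?_
    exact (hFc.fderiv (𝕜 := ℝ)).mono fun z hz ↦ mt (fun h ↦ by simp [h]) hz
  have hnonneg : 0 ≤ ∫ z, ((C / (‖z‖ ^ 2 + E)) ^ 2 * ‖gradient w z‖ ^ 2
      - C ^ 2 * (‖z‖ ^ 2 - 4 * E) / (‖z‖ ^ 2 + E) ^ 4 * w z ^ 2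
      + (1 / 2) * (fderiv ℝ F z z + 4 * F z)) :=
    integral_nonneg fun z ↦ by rw [hpt z]; positivity
  rw [integral_add (hI2.sub' hI3) ((hIdF.fun_add (hIF.const_mul 4)).const_mul _),
    integral_sub hI2 hI3, integral_const_mul, integral_add hIdF (hIF.const_mul 4),
    integral_const_mul, hEuler] at hnonneg
  linarith

/-- Weight algebra of the normalisation: with `l² = 4/E` and `σ = 4Eτ/C²`,
`(4πσ)^{-2} u_l⁴ = (4πτ)^{-2} (C/(m+E))⁴`, `u_l = l·4/(l²m+4)`. [folklore] -/
theorem profile_weight₀ {C E τ m : ℝ} (hC : 0 < C) (hE : 0 < E) (hτ : 0 < τ) (hm : 0 ≤ m)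
    {l : ℝ} (hl2 : l ^ 2 = 4 / E) :
    (4 * Real.pi * (4 * E * τ / C ^ 2)) ^ (-(4 : ℝ) / 2) * (l * (4 / (l ^ 2 * m + 4))) ^ 4 =
      (4 * Real.pi * τ) ^ (-(4 : ℝ) / 2) * (C / (m + E)) ^ 4 := by
  rw [rpow_neg_four_half (by positivity), rpow_neg_four_half (by positivity)]
  have e1 : (l * (4 / (l ^ 2 * m + 4))) ^ 4 = (l ^ 2) ^ 2 * (4 / (l ^ 2 * m + 4)) ^ 4 := by ring
  rw [e1, hl2]
  have hpi := Real.pi_pos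
  have hmE : 0 < m + E := by positivity
  field_simp

/-- Weight algebra of the full integrand: the S1 integrand at dilation `l² = 4/E` and scale
`σ = 4Eτ/C²` is the `ψ₀`-weighted integrand with curvature weight `48E/C²`, `ψ₀ = C/(m+E)`.
[folklore] -/
theorem profile_weight {C E τ m : ℝ} (hC : 0 < C) (hE : 0 < E) (hτ : 0 < τ) (hm : 0 ≤ m)
    {l : ℝ} (hl2 : l ^ 2 = 4 / E) (V2 Gn Lg : ℝ) :
    (4 * E * τ / C ^ 2 * (12 * V2 + 4 * ((l * (4 / (l ^ 2 * m + 4)))⁻¹ ^ 2 * Gn)) - Lg - 4 * V2) *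
        ((4 * Real.pi * (4 * E * τ / C ^ 2)) ^ (-(4 : ℝ) / 2) * (l * (4 / (l ^ 2 * m + 4))) ^ 4) =
      (τ * (48 * E / C ^ 2 * V2 + 4 * ((C / (m + E))⁻¹ ^ 2 * Gn)) - Lg - 4 * V2) *
        ((4 * Real.pi * τ) ^ (-(4 : ℝ) / 2) * (C / (m + E)) ^ 4) := by
  rw [rpow_neg_four_half (by positivity), rpow_neg_four_half (by positivity)]
  have e1 : (l * (4 / (l ^ 2 * m + 4))) ^ 4 = (l ^ 2) ^ 2 * (4 / (l ^ 2 * m + 4)) ^ 4 := by ring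
  have e2 : (l * (4 / (l ^ 2 * m + 4)))⁻¹ ^ 2 = (l ^ 2)⁻¹ * ((4 / (l ^ 2 * m + 4)))⁻¹ ^ 2 := by
    rw [mul_inv, mul_pow, inv_pow]
  rw [e1, e2, hl2]
  have hpi := Real.pi_pos
  have hmE : 0 < m + E := by positivity
  field_simp
  ring

/-- **RoundBound for the bubble `ψ₀ = C/(‖y‖²+E)` at every scale** (`ψ₀²δ` is the round sphere of
radius `R`, `R² = C²/(4E)`, `12/R² = 48E/C²`): S1 `stub_roundClauseEuclidean` at `l² = 4/E`,
`σ = 4Eτ/C²`. [cite: CaoHamiltonIlmanen2004, Thm 3.4] -/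
theorem roundClause_profile {C E : ℝ} (hC : 0 < C) (hE : 0 < E) {τ : ℝ} (hτ : 0 < τ)
    {v : EuclideanSpace ℝ (Fin 4) → ℝ} (hv : ContDiff ℝ ∞ v) (hcs : HasCompactSupport v)
    (hnorm : ∫ y, (4 * Real.pi * τ) ^ (-(4 : ℝ) / 2) * (v y) ^ 2 * (C / (‖y‖ ^ 2 + E)) ^ 4 = 1) :
    Real.log 6 - 2 ≤
      ∫ y, (τ * (48 * E / C ^ 2 * (v y) ^ 2 + 4 * ((C / (‖y‖ ^ 2 + E))⁻¹ ^ 2 * ‖gradient v y‖ ^ 2))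
          - (v y) ^ 2 * Real.log ((v y) ^ 2) - 4 * (v y) ^ 2)
          * ((4 * Real.pi * τ) ^ (-(4 : ℝ) / 2) * (C / (‖y‖ ^ 2 + E)) ^ 4) := by
  obtain ⟨l, hl, hl2⟩ : ∃ l : ℝ, 0 < l ∧ l ^ 2 = 4 / E :=
    ⟨Real.sqrt (4 / E), Real.sqrt_pos.2 (by positivity), Real.sq_sqrt (by positivity)⟩
  have hσ : 0 < 4 * E * τ / C ^ 2 := by positivity
  have hnorm' : ∫ y, (4 * Real.pi * (4 * E * τ / C ^ 2)) ^ (-(4 : ℝ) / 2) * (v y) ^ 2 *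
      (l * (4 / (l ^ 2 * ‖y‖ ^ 2 + 4))) ^ 4 = 1 := by
    rw [← hnorm]
    refine integral_congr_ae (Eventually.of_forall fun y ↦ ?_)
    have hw := profile_weight₀ (m := ‖y‖ ^ 2) hC hE hτ (sq_nonneg _) hl2
    calc (4 * Real.pi * (4 * E * τ / C ^ 2)) ^ (-(4 : ℝ) / 2) * (v y) ^ 2 *
          (l * (4 / (l ^ 2 * ‖y‖ ^ 2 + 4))) ^ 4
        = (v y) ^ 2 * ((4 * Real.pi * (4 * E * τ / C ^ 2)) ^ (-(4 : ℝ) / 2) *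
          (l * (4 / (l ^ 2 * ‖y‖ ^ 2 + 4))) ^ 4) := by ring
      _ = (v y) ^ 2 * ((4 * Real.pi * τ) ^ (-(4 : ℝ) / 2) * (C / (‖y‖ ^ 2 + E)) ^ 4) := by rw [hw]
      _ = _ := by ring
  have hS1 := stub_roundClauseEuclidean l hl (4 * E * τ / C ^ 2) hσ v hv hcs hnorm'
  refine hS1.trans_eq (integral_congr_ae (Eventually.of_forall fun y ↦ ?_))
  exact profile_weight (m := ‖y‖ ^ 2) hC hE hτ (sq_nonneg _) hl2 _ _ _

/-- `∇(k f) = k ∇f` at a point of differentiability. [folklore] -/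
theorem gradient_const_mul {f : EuclideanSpace ℝ (Fin 4) → ℝ} {z : EuclideanSpace ℝ (Fin 4)}
    (hf : DifferentiableAt ℝ f z) (k : ℝ) :
    gradient (fun y ↦ k * f y) z = k • gradient f z := by
  rw [gradient, fderiv_const_mul hf k, gradient, map_smul]

/-- `∇(μ(1 + β‖y‖²)) = 2μβ y`. [folklore] -/
theorem hasGradientAt_u (μ β : ℝ) (z : EuclideanSpace ℝ (Fin 4)) :
    HasGradientAt (fun y : EuclideanSpace ℝ (Fin 4) ↦ μ * (1 + β * ‖y‖ ^ 2))
      ((2 * μ * β) • z) z := by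
  have hm : HasFDerivAt (fun y : EuclideanSpace ℝ (Fin 4) ↦ ‖y‖ ^ 2) (2 • innerSL ℝ z) z :=
    (hasStrictFDerivAt_norm_sq z).hasFDerivAt
  have h := ((hm.const_mul β).const_add 1).const_mul μ
  rw [hasGradientAt_iff_hasFDerivAt]
  refine h.congr_fderiv ?_
  ext y
  simp only [InnerProductSpace.toDual_apply_apply, real_inner_smul_left,
    FunLike.coe_smul, Pi.smul_apply, smul_eq_mul, innerSL_apply_apply]
  simp only [nsmul_eq_mul, Nat.cast_ofNat]
  ring

/-- Gradient of the substituted test function `w = u² v`, `u = μ(1 + β‖y‖²)`: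
`∇w = u² ∇v + (2 u v · 2μβ) y`. [folklore] -/
theorem hasGradientAt_w (μ β : ℝ) {v : EuclideanSpace ℝ (Fin 4) → ℝ} {z : EuclideanSpace ℝ (Fin 4)}
    (hv : DifferentiableAt ℝ v z) :
    HasGradientAt (fun y : EuclideanSpace ℝ (Fin 4) ↦ (μ * (1 + β * ‖y‖ ^ 2)) ^ 2 * v y)
      ((μ * (1 + β * ‖z‖ ^ 2)) ^ 2 • gradient v z +
        (2 * (μ * (1 + β * ‖z‖ ^ 2)) * v z * (2 * μ * β)) • z) z := by
  have hu := (hasGradientAt_u μ β z).hasFDerivAt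
  have h := (hu.pow 2).mul hv.hasFDerivAt
  rw [hasGradientAt_iff_hasFDerivAt]
  refine h.congr_fderiv ?_
  ext y
  simp only [InnerProductSpace.toDual_apply_apply, real_inner_smul_left, inner_add_left,
    _root_.add_apply, FunLike.coe_smul, Pi.smul_apply, smul_eq_mul, inner_gradient_left]
  simp only [nsmul_eq_mul, Nat.cast_ofNat]
  ring

end CapClauseEuclideanSchwarzschildAux

/-- **Registered helper `helper_capClauseEuclideanSchwarzschild` of stub E2** (line
`green-blowup-conformal-entropy`, crux stmt-SmoothPoincare4-10871): the Hardy identity of the bubble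
`ψ₀ = C/(‖z‖²+E)` on `ℝ⁴`, `∫ C²(‖z‖² − 4E)/(‖z‖²+E)⁴ w² ≤ ∫ ψ₀² ‖∇w‖²` for every smooth compactly
supported `w` (`CapClauseEuclideanSchwarzschildAux.hardy`). [cite: LeeParker1987, §6] [folklore] -/
theorem helper_capClauseEuclideanSchwarzschild :
    ∀ (C E : ℝ), 0 < E → ∀ w : EuclideanSpace ℝ (Fin 4) → ℝ, ContDiff ℝ ∞ w → HasCompactSupport w →
      ∫ z, C ^ 2 * (‖z‖ ^ 2 - 4 * E) / (‖z‖ ^ 2 + E) ^ 4 * w z ^ 2 ≤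
        ∫ z, (C / (‖z‖ ^ 2 + E)) ^ 2 * ‖gradient w z‖ ^ 2 :=
  fun _ _ hE _ hw hwc ↦ CapClauseEuclideanSchwarzschildAux.hardy hE hw hwc

end Summit.SmoothPoincare4.SmoothPoincare4.Theorems

end
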